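import Summits.Parity.GeneralizedHardyLittlewood.Theorems.ChenParityOracleBLAPHostParityFromBrickSwitchedClass
import Summits.Parity.GeneralizedHardyLittlewood.Theorems.ChenParityOracleBLAPHostParityFromBrickSwitchedBad
import HarnessLib

/-!
# Route `ChenParityOracleBLAP` — crux S1 = `HostParityFromBrick` (stmt-Parity-20045): the switched host at one `x`

Support file for the switched half `K1 → K2 → HP2` of S1.  At a fixed (large) `x`, with
`ρ ∈ (1, 6/5]`, the twisted level sum of Chen's switched host
`∑_{d ≤ x^{1/2−ε}} |∑_{e ∈ B(x), d ∣ e} λ(e)|` is bounded by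

* the GOOD `ρ`-adic classes (at most `(⌊log(x+2)/log ρ⌋ + 1)³` of them), each a K-box costing
  `(1 + (1 + log x)²) x/(log x)^A` under K1, K2 (`sum_abs_good_le`, via `sum_abs_product3_le`);
* the BAD classes (`sum_abs_bad_le`, file `…SwitchedBad`).

This is `switched_level_sum_le_at`; the choice `ρ = 1 + (log x)^{-9}`, `A = 40` and the limit
`x → ∞` are taken in the closing file of the switched half.

References: Chen Jing-run, Sci. Sinica 16 (1973) [ChenSciSinica1973]; M. B. Nathanson, *Additive
Number Theory: The Classical Bases* (1996), §10.2, (10.13) [Nathanson1996]; G. Harman,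
*Prime-Detecting Sieves* (2007), Ch. 3 [Harman2007].
-/

namespace Summit.Parity.GeneralizedHardyLittlewood.Theorems

open Finset Real
open Literature.NumberTheory.Sieve.Chen

/-! ### The good classes -/

/-- **The good classes of the switched host.**  Under K1, K2 at `x` (hypotheses as in
`brick_box_sum_le`), for `ρ ∈ (1, 6/5]` with `x + 2 ≤ ρ³x`, `w₀ ≤ ⌈x^{1/8}⌉`,
`x^{1/3−δ} ≤ x^{1/3}/ρ − 1`, `x ≥ 24`: the triples of `B(x)` in GOOD classes contribute to the twisted
level sum at most `(⌊log(x+2)/log ρ⌋ + 1)³ · (1 + (1 + log x)²) · x/(log x)^A` (each good class is a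
K-box, `sum_abs_product3_le`; there are at most `(I+1)³` classes, `I = ⌊log(x+2)/log ρ⌋`). -/
theorem sum_abs_good_le {x : ℕ} (hx24 : 24 ≤ x) {δ ε A : ℝ} (hε : 0 ≤ ε)
    (hw : 2 < Real.exp (Real.log x / Real.log (Real.log x)))
    (hK1 : ∀ M N : ℕ, (x : ℝ) ^ (1 / 3 - δ) ≤ M → (M : ℝ) ≤ (x : ℝ) ^ (1 / 2 : ℝ) →
      (x : ℝ) ^ (1 - δ) ≤ (M : ℝ) * N → (M : ℝ) * N ≤ x → ∀ α β : ℕ → ℝ, (∀ n, |α n| ≤ 1) →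
      (∀ n, |β n| ≤ 1) →
      (∀ n, α n ≠ 0 → ∀ p ∈ n.primeFactors, Real.exp (Real.log x / Real.log (Real.log x)) ≤ p) →
      (∀ n, β n ≠ 0 → ∀ p ∈ n.primeFactors, Real.exp (Real.log x / Real.log (Real.log x)) ≤ p) →
      ∀ h : ℤ, (h = 2 ∨ h = -2) →
      |∑ m ∈ Finset.Ioc M (2 * M), ∑ n ∈ Finset.Ioc N (2 * N),
        α m * β n * (ArithmeticFunction.liouville (Int.toNat ((m : ℤ) * n + h)) : ℝ)| ≤
        (x : ℝ) / Real.log x ^ A)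
    (hK2 : ∀ M N : ℕ, (x : ℝ) ^ (1 / 3 - δ) ≤ M → (M : ℝ) ≤ (x : ℝ) ^ (1 / 2 : ℝ) →
      (x : ℝ) ^ (1 - δ) ≤ (M : ℝ) * N → (M : ℝ) * N ≤ x → ∀ α β : ℕ → ℝ, (∀ n, |α n| ≤ 1) →
      (∀ n, |β n| ≤ 1) →
      (∀ n, α n ≠ 0 → ∀ p ∈ n.primeFactors, Real.exp (Real.log x / Real.log (Real.log x)) ≤ p) →
      (∀ n, β n ≠ 0 → ∀ p ∈ n.primeFactors, Real.exp (Real.log x / Real.log (Real.log x)) ≤ p) →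
      ∀ h : ℤ, (h = 2 ∨ h = -2) →
      (∑ d ∈ (Finset.Icc 1 ⌊(x : ℝ) ^ (1 / 2 - ε)⌋₊).filter (fun d : ℕ => Odd d),
        |(∑ m ∈ Finset.Ioc M (2 * M), ∑ n ∈ (Finset.Ioc N (2 * N)).filter
            (fun n : ℕ => (d : ℤ) ∣ (m : ℤ) * n + h),
            α m * β n * (ArithmeticFunction.liouville (Int.toNat ((m : ℤ) * n + h)) : ℝ)) -
          (Nat.totient d : ℝ)⁻¹ * ∑ m ∈ Finset.Ioc M (2 * M), ∑ n ∈ Finset.Ioc N (2 * N),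
            α m * β n * (ArithmeticFunction.liouville (Int.toNat ((m : ℤ) * n + h)) : ℝ)|) ≤
        (x : ℝ) / Real.log x ^ A)
    {ρ : ℝ} (hρ : 1 < ρ) (hρ2 : ρ ≤ 6 / 5) (hρx : (x : ℝ) + 2 ≤ ρ ^ 3 * x)
    (hw0z : Real.exp (Real.log x / Real.log (Real.log x)) ≤ twinZ x)
    (hxδ : (x : ℝ) ^ (1 / 3 - δ) ≤ (x : ℝ) ^ (1 / 3 : ℝ) / ρ - 1) :
    ∑ d ∈ Finset.Icc 1 ⌊(x : ℝ) ^ (1 / 2 - ε)⌋₊, |∑ t ∈ ((Finset.range (x + 3) ×ˢ Finset.range (x + 3) ×ˢ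
        Finset.range (x + 3)).filter
        (fun t : ℕ × ℕ × ℕ => t.1.Prime ∧ t.2.1.Prime ∧ t.2.2.Prime ∧ twinZ x ≤ t.1 ∧ t.1 < twinY x ∧
          twinY x ≤ t.2.1 ∧ t.2.1 ≤ t.2.2 ∧ t.1 * t.2.1 * t.2.2 ≤ x + 2)).filter
        (fun t : ℕ × ℕ × ℕ => ⌊Real.log t.2.1 / Real.log ρ⌋₊ < ⌊Real.log t.2.2 / Real.log ρ⌋₊ ∧
          ρ ^ (⌊Real.log t.1 / Real.log ρ⌋₊ + ⌊Real.log t.2.1 / Real.log ρ⌋₊ +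
            ⌊Real.log t.2.2 / Real.log ρ⌋₊ + 3) ≤ (x : ℝ) + 2 ∧
          8 * (x : ℝ) ^ (1 - δ) < ρ ^ (⌊Real.log t.1 / Real.log ρ⌋₊ + ⌊Real.log t.2.1 / Real.log ρ⌋₊ +
            ⌊Real.log t.2.2 / Real.log ρ⌋₊ + 3)),
        (if d ∣ t.1 * t.2.1 * t.2.2 - 2 then
          (ArithmeticFunction.liouville (t.1 * t.2.1 * t.2.2 - 2) : ℝ) else 0)| ≤
      (((⌊Real.log ((x + 2 : ℕ) : ℝ) / Real.log ρ⌋₊ + 1) ^ 3 : ℕ) : ℝ) *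
        ((1 + (1 + Real.log x) ^ 2) * ((x : ℝ) / Real.log x ^ A)) := by
  classical
  set T := ((Finset.range (x + 3) ×ˢ Finset.range (x + 3) ×ˢ Finset.range (x + 3)).filter
        (fun t : ℕ × ℕ × ℕ => t.1.Prime ∧ t.2.1.Prime ∧ t.2.2.Prime ∧ twinZ x ≤ t.1 ∧ t.1 < twinY x ∧
          twinY x ≤ t.2.1 ∧ t.2.1 ≤ t.2.2 ∧ t.1 * t.2.1 * t.2.2 ≤ x + 2)) with hTdef
  set idx : ℕ → ℕ := fun p => ⌊Real.log p / Real.log ρ⌋₊ with hidx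
  set good : ℕ × ℕ × ℕ → Prop := fun t => idx t.2.1 < idx t.2.2 ∧
    ρ ^ (idx t.1 + idx t.2.1 + idx t.2.2 + 3) ≤ (x : ℝ) + 2 ∧
    8 * (x : ℝ) ^ (1 - δ) < ρ ^ (idx t.1 + idx t.2.1 + idx t.2.2 + 3) with hgood
  set cls : ℕ × ℕ × ℕ → ℕ × ℕ × ℕ := fun t => (idx t.1, idx t.2.1, idx t.2.2) with hcls
  set D : ℕ := ⌊(x : ℝ) ^ (1 / 2 - ε)⌋₊ with hD
  set B : ℝ := (1 + (1 + Real.log x) ^ 2) * ((x : ℝ) / Real.log x ^ A) with hB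
  set I : ℕ := ⌊Real.log ((x + 2 : ℕ) : ℝ) / Real.log ρ⌋₊ with hI
  set F : ℕ → ℕ × ℕ × ℕ → ℝ := fun d t => if d ∣ t.1 * t.2.1 * t.2.2 - 2 then
    (ArithmeticFunction.liouville (t.1 * t.2.1 * t.2.2 - 2) : ℝ) else 0 with hF
  have hx : 1 ≤ x := by omega
  have hB0 : 0 ≤ B := by
    have hl : 0 ≤ Real.log x := Real.log_nonneg (by exact_mod_cast hx)
    positivity
  have hT : ∀ t ∈ T, t.1.Prime ∧ t.2.1.Prime ∧ t.2.2.Prime ∧ twinZ x ≤ t.1 ∧ t.1 < twinY x ∧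
      twinY x ≤ t.2.1 ∧ t.2.1 ≤ t.2.2 ∧ t.1 * t.2.1 * t.2.2 ≤ x + 2 := by
    intro t ht; rw [hTdef, Finset.mem_filter] at ht; exact ht.2
  set G := T.filter good with hG
  set C := G.image cls with hC
  -- fibre decomposition over the classes
  have hfib : ∀ d, ∑ t ∈ G, F d t = ∑ c ∈ C, ∑ t ∈ G.filter (fun t => cls t = c), F d t :=
    fun d => (Finset.sum_fiberwise_of_maps_to (fun t ht => Finset.mem_image_of_mem cls ht) (F d)).symm
  -- each class is a product of primes sets and costs at most `B`
  have hclass : ∀ c ∈ C, ∑ d ∈ Finset.Icc 1 D, |∑ t ∈ G.filter (fun t => cls t = c), F d t| ≤ B := by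
    intro c hc
    rw [hC, Finset.mem_image] at hc
    obtain ⟨t₀, ht₀, hct₀⟩ := hc
    rw [hG, Finset.mem_filter] at ht₀
    obtain ⟨-, hg₀⟩ := ht₀
    obtain ⟨hij, htop, hbot⟩ := hg₀
    -- coordinates of `c`
    have hc1 : c.1 = idx t₀.1 := by rw [← hct₀]
    have hc2 : c.2.1 = idx t₀.2.1 := by rw [← hct₀]
    have hc3 : c.2.2 = idx t₀.2.2 := by rw [← hct₀]
    rw [← hc1, ← hc2, ← hc3] at htop hbot
    rw [← hc2, ← hc3] at hij
    -- the fibre is the product `P₁ × P₂ × P₃`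
    have hfibre : G.filter (fun t => cls t = c) =
        T.filter (fun t => idx t.1 = c.1 ∧ idx t.2.1 = c.2.1 ∧ idx t.2.2 = c.2.2) := by
      rw [hG, Finset.filter_filter]
      refine Finset.filter_congr fun t _ => ?_
      constructor
      · rintro ⟨-, h⟩
        rw [← h]
        exact ⟨rfl, rfl, rfl⟩
      · rintro ⟨h1, h2, h3⟩
        refine ⟨?_, ?_⟩
        · show idx t.2.1 < idx t.2.2 ∧ ρ ^ (idx t.1 + idx t.2.1 + idx t.2.2 + 3) ≤ (x : ℝ) + 2 ∧
            8 * (x : ℝ) ^ (1 - δ) < ρ ^ (idx t.1 + idx t.2.1 + idx t.2.2 + 3)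
          rw [h1, h2, h3]; exact ⟨hij, htop, hbot⟩
        · show (idx t.1, idx t.2.1, idx t.2.2) = c
          rw [h1, h2, h3]
    rw [hfibre, hTdef, filter_index_eq_product hρ hij htop]
    refine sum_abs_product3_le hx24 hε hw hK1 hK2 hρ hρ2 hρx hw0z hxδ hij htop hbot ?_ ?_ ?_
    · intro p hp
      rw [Finset.mem_filter] at hp
      obtain ⟨-, hpr, hz, hy, hk⟩ := hp
      refine ⟨hpr, hz, hy, ?_, ?_⟩
      · have := rho_pow_floor_le hρ hpr.one_lt.le; rw [← hk]; exact this
      · have := lt_rho_pow_floor_succ hρ p; rw [← hk]; exact this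
    · intro p hp
      rw [Finset.mem_filter] at hp
      obtain ⟨-, hpr, hy, hi⟩ := hp
      refine ⟨hpr, hy, ?_, ?_⟩
      · have := rho_pow_floor_le hρ hpr.one_lt.le; rw [← hi]; exact this
      · have := lt_rho_pow_floor_succ hρ p; rw [← hi]; exact this
    · intro p hp
      rw [Finset.mem_filter] at hp
      obtain ⟨-, hpr, hy, hj⟩ := hp
      refine ⟨hpr, hy, ?_, ?_⟩
      · have := rho_pow_floor_le hρ hpr.one_lt.le; rw [← hj]; exact this
      · have := lt_rho_pow_floor_succ hρ p; rw [← hj]; exact this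
  -- the number of classes
  have hCcard : #C ≤ (I + 1) ^ 3 := by
    have hsub : C ⊆ Finset.range (I + 1) ×ˢ (Finset.range (I + 1) ×ˢ Finset.range (I + 1)) := by
      intro c hc
      rw [hC, Finset.mem_image] at hc
      obtain ⟨t, ht, rfl⟩ := hc
      have htT : t ∈ T := (Finset.mem_filter.mp ht).1
      obtain ⟨h1, h2, h3, -, -, -, -, hprod⟩ := hT t htT
      have h1' : 1 ≤ t.1 := h1.one_lt.le
      have h2' : 1 ≤ t.2.1 := h2.one_lt.le
      have h3' : 1 ≤ t.2.2 := h3.one_lt.le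
      have hb1 : t.1 ≤ x + 2 := by
        calc t.1 = t.1 * 1 * 1 := by ring
          _ ≤ t.1 * t.2.1 * t.2.2 := by gcongr
          _ ≤ x + 2 := hprod
      have hb2 : t.2.1 ≤ x + 2 := by
        calc t.2.1 = 1 * t.2.1 * 1 := by ring
          _ ≤ t.1 * t.2.1 * t.2.2 := by gcongr
          _ ≤ x + 2 := hprod
      have hb3 : t.2.2 ≤ x + 2 := by
        calc t.2.2 = 1 * 1 * t.2.2 := by ring
          _ ≤ t.1 * t.2.1 * t.2.2 := by gcongr
          _ ≤ x + 2 := hprod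
      simp only [Finset.mem_product, Finset.mem_range, hcls]
      refine ⟨Nat.lt_succ_of_le ?_, Nat.lt_succ_of_le ?_, Nat.lt_succ_of_le ?_⟩
      · exact floor_log_div_mono hρ hb1
      · exact floor_log_div_mono hρ hb2
      · exact floor_log_div_mono hρ hb3
    calc #C ≤ #(Finset.range (I + 1) ×ˢ (Finset.range (I + 1) ×ˢ Finset.range (I + 1))) :=
          Finset.card_le_card hsub
      _ = (I + 1) ^ 3 := by simp [Finset.card_product]; ring
  -- assemble
  calc ∑ d ∈ Finset.Icc 1 D, |∑ t ∈ G, F d t|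
      = ∑ d ∈ Finset.Icc 1 D, |∑ c ∈ C, ∑ t ∈ G.filter (fun t => cls t = c), F d t| := by
        simp_rw [hfib]
    _ ≤ ∑ d ∈ Finset.Icc 1 D, ∑ c ∈ C, |∑ t ∈ G.filter (fun t => cls t = c), F d t| :=
        Finset.sum_le_sum fun d _ => Finset.abs_sum_le_sum_abs _ _
    _ = ∑ c ∈ C, ∑ d ∈ Finset.Icc 1 D, |∑ t ∈ G.filter (fun t => cls t = c), F d t| :=
        Finset.sum_comm
    _ ≤ ∑ _c ∈ C, B := Finset.sum_le_sum hclass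
    _ = #C * B := by rw [Finset.sum_const, nsmul_eq_mul]
    _ ≤ (((I + 1) ^ 3 : ℕ) : ℝ) * B := by
        exact mul_le_mul_of_nonneg_right (by exact_mod_cast hCcard) hB0


/-! ### The switched host at one `x` -/

/-- **The twisted level sum of the switched host at one `x`.**  Under K1 and K2 at `x` (on the
`δ`-window, saving `A`, level `x^{1/2−ε}`), for `ρ ∈ (1, 6/5]` with `x + 2 ≤ ρ³x`,
`w₀ = exp(log x/log log x) ∈ (2, ⌈x^{1/8}⌉]`, `x^{1/3−δ} ≤ x^{1/3}/ρ − 1` and `x ≥ 24`: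
`∑_{d ≤ x^{1/2−ε}} |∑_{e ∈ B(x), d ∣ e} λ(e)| ≤ (⌊log(x+2)/log ρ⌋+1)³ (1 + (1+log x)²) x/(log x)^A`
`+ ⌊8x^{1−δ}⌋(1 + log⌊8x^{1−δ}⌋) + √((ρ−1)(x+2)(1+log y) + y√(x+2) + 3(ρ−1)(x+2) + 1) · √((x+2)(1+log(x+2))³)`,
`y = ⌈(x+3)^{1/3}⌉`. -/
theorem switched_level_sum_le_at {x : ℕ} (hx24 : 24 ≤ x) {δ ε A : ℝ} (hε : 0 ≤ ε)
    (hw : 2 < Real.exp (Real.log x / Real.log (Real.log x)))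
    (hK1 : ∀ M N : ℕ, (x : ℝ) ^ (1 / 3 - δ) ≤ M → (M : ℝ) ≤ (x : ℝ) ^ (1 / 2 : ℝ) →
      (x : ℝ) ^ (1 - δ) ≤ (M : ℝ) * N → (M : ℝ) * N ≤ x → ∀ α β : ℕ → ℝ, (∀ n, |α n| ≤ 1) →
      (∀ n, |β n| ≤ 1) →
      (∀ n, α n ≠ 0 → ∀ p ∈ n.primeFactors, Real.exp (Real.log x / Real.log (Real.log x)) ≤ p) →
      (∀ n, β n ≠ 0 → ∀ p ∈ n.primeFactors, Real.exp (Real.log x / Real.log (Real.log x)) ≤ p) →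
      ∀ h : ℤ, (h = 2 ∨ h = -2) →
      |∑ m ∈ Finset.Ioc M (2 * M), ∑ n ∈ Finset.Ioc N (2 * N),
        α m * β n * (ArithmeticFunction.liouville (Int.toNat ((m : ℤ) * n + h)) : ℝ)| ≤
        (x : ℝ) / Real.log x ^ A)
    (hK2 : ∀ M N : ℕ, (x : ℝ) ^ (1 / 3 - δ) ≤ M → (M : ℝ) ≤ (x : ℝ) ^ (1 / 2 : ℝ) →
      (x : ℝ) ^ (1 - δ) ≤ (M : ℝ) * N → (M : ℝ) * N ≤ x → ∀ α β : ℕ → ℝ, (∀ n, |α n| ≤ 1) →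
      (∀ n, |β n| ≤ 1) →
      (∀ n, α n ≠ 0 → ∀ p ∈ n.primeFactors, Real.exp (Real.log x / Real.log (Real.log x)) ≤ p) →
      (∀ n, β n ≠ 0 → ∀ p ∈ n.primeFactors, Real.exp (Real.log x / Real.log (Real.log x)) ≤ p) →
      ∀ h : ℤ, (h = 2 ∨ h = -2) →
      (∑ d ∈ (Finset.Icc 1 ⌊(x : ℝ) ^ (1 / 2 - ε)⌋₊).filter (fun d : ℕ => Odd d),
        |(∑ m ∈ Finset.Ioc M (2 * M), ∑ n ∈ (Finset.Ioc N (2 * N)).filter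
            (fun n : ℕ => (d : ℤ) ∣ (m : ℤ) * n + h),
            α m * β n * (ArithmeticFunction.liouville (Int.toNat ((m : ℤ) * n + h)) : ℝ)) -
          (Nat.totient d : ℝ)⁻¹ * ∑ m ∈ Finset.Ioc M (2 * M), ∑ n ∈ Finset.Ioc N (2 * N),
            α m * β n * (ArithmeticFunction.liouville (Int.toNat ((m : ℤ) * n + h)) : ℝ)|) ≤
        (x : ℝ) / Real.log x ^ A)
    {ρ : ℝ} (hρ : 1 < ρ) (hρ2 : ρ ≤ 6 / 5) (hρx : (x : ℝ) + 2 ≤ ρ ^ 3 * x)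
    (hw0z : Real.exp (Real.log x / Real.log (Real.log x)) ≤ twinZ x)
    (hxδ : (x : ℝ) ^ (1 / 3 - δ) ≤ (x : ℝ) ^ (1 / 3 : ℝ) / ρ - 1) :
    ∑ d ∈ Finset.Icc 1 ⌊(x : ℝ) ^ (1 / 2 - ε)⌋₊,
        |∑ e ∈ (chenSetB x).filter (fun e => d ∣ e), (ArithmeticFunction.liouville e : ℝ)| ≤
      (((⌊Real.log ((x + 2 : ℕ) : ℝ) / Real.log ρ⌋₊ + 1) ^ 3 : ℕ) : ℝ) *
          ((1 + (1 + Real.log x) ^ 2) * ((x : ℝ) / Real.log x ^ A)) +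
        ((⌊8 * (x : ℝ) ^ (1 - δ)⌋₊ : ℝ) * (1 + Real.log (⌊8 * (x : ℝ) ^ (1 - δ)⌋₊ : ℕ)) +
          Real.sqrt ((ρ - 1) * ((x + 2 : ℕ) : ℝ) * (1 + Real.log (twinY x)) +
              twinY x * Real.sqrt ((x + 2 : ℕ) : ℝ) + (3 * (ρ - 1) * ((x + 2 : ℕ) : ℝ) + 1)) *
            Real.sqrt (((x + 2 : ℕ) : ℝ) * (1 + Real.log ((x + 2 : ℕ) : ℝ)) ^ 3)) := by
  classical
  set T := ((Finset.range (x + 3) ×ˢ Finset.range (x + 3) ×ˢ Finset.range (x + 3)).filter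
        (fun t : ℕ × ℕ × ℕ => t.1.Prime ∧ t.2.1.Prime ∧ t.2.2.Prime ∧ twinZ x ≤ t.1 ∧ t.1 < twinY x ∧
          twinY x ≤ t.2.1 ∧ t.2.1 ≤ t.2.2 ∧ t.1 * t.2.1 * t.2.2 ≤ x + 2)) with hTdef
  set good : ℕ × ℕ × ℕ → Prop := fun t =>
    ⌊Real.log t.2.1 / Real.log ρ⌋₊ < ⌊Real.log t.2.2 / Real.log ρ⌋₊ ∧
    ρ ^ (⌊Real.log t.1 / Real.log ρ⌋₊ + ⌊Real.log t.2.1 / Real.log ρ⌋₊ +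
      ⌊Real.log t.2.2 / Real.log ρ⌋₊ + 3) ≤ (x : ℝ) + 2 ∧
    8 * (x : ℝ) ^ (1 - δ) < ρ ^ (⌊Real.log t.1 / Real.log ρ⌋₊ + ⌊Real.log t.2.1 / Real.log ρ⌋₊ +
      ⌊Real.log t.2.2 / Real.log ρ⌋₊ + 3) with hgood
  set F : ℕ → ℕ × ℕ × ℕ → ℝ := fun d t => if d ∣ t.1 * t.2.1 * t.2.2 - 2 then
    (ArithmeticFunction.liouville (t.1 * t.2.1 * t.2.2 - 2) : ℝ) else 0 with hF
  have hgoodpart := sum_abs_good_le hx24 hε hw hK1 hK2 hρ hρ2 hρx hw0z hxδ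
  have hbadpart := sum_abs_bad_le hx24 (δ := δ) hρ hρ2 ⌊(x : ℝ) ^ (1 / 2 - ε)⌋₊
  -- rewrite the `B(x)`-sums as sums over triples and split good/bad
  have hre : ∀ d : ℕ, ∑ e ∈ (chenSetB x).filter (fun e => d ∣ e),
      (ArithmeticFunction.liouville e : ℝ) = ∑ t ∈ T, F d t := by
    intro d
    rw [Finset.sum_filter, sum_chenSetB_eq_sum_triples]
  have hsplit : ∀ d : ℕ, ∑ t ∈ T, F d t =
      (∑ t ∈ T.filter good, F d t) + ∑ t ∈ T.filter (fun t => ¬ good t), F d t :=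
    fun d => (Finset.sum_filter_add_sum_filter_not T good (F d)).symm
  calc ∑ d ∈ Finset.Icc 1 ⌊(x : ℝ) ^ (1 / 2 - ε)⌋₊,
        |∑ e ∈ (chenSetB x).filter (fun e => d ∣ e), (ArithmeticFunction.liouville e : ℝ)|
      = ∑ d ∈ Finset.Icc 1 ⌊(x : ℝ) ^ (1 / 2 - ε)⌋₊,
          |(∑ t ∈ T.filter good, F d t) + ∑ t ∈ T.filter (fun t => ¬ good t), F d t| := by
        simp_rw [hre, hsplit]
    _ ≤ ∑ d ∈ Finset.Icc 1 ⌊(x : ℝ) ^ (1 / 2 - ε)⌋₊,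
          (|∑ t ∈ T.filter good, F d t| + |∑ t ∈ T.filter (fun t => ¬ good t), F d t|) :=
        Finset.sum_le_sum fun d _ => abs_add_le _ _
    _ = (∑ d ∈ Finset.Icc 1 ⌊(x : ℝ) ^ (1 / 2 - ε)⌋₊, |∑ t ∈ T.filter good, F d t|) +
          ∑ d ∈ Finset.Icc 1 ⌊(x : ℝ) ^ (1 / 2 - ε)⌋₊, |∑ t ∈ T.filter (fun t => ¬ good t), F d t| :=
        Finset.sum_add_distrib
    _ ≤ _ := add_le_add hgoodpart hbadpart

end Summit.Parity.GeneralizedHardyLittlewood.Theorems
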